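import Literature.Analysis.FluidPDE.ForcedFourierPicardBounds
import Literature.Analysis.FluidPDE.FourierL2PicardWeighted
import HarnessLib

/-!
# The forced Picard iteration: uniform envelopes and uniform weighted bounds of all orders
# (the `e^{-λt}` method with a forcing term)

Fourth file of the FORCED twin of the weighted-`L²` Fourier-side construction of the local smooth
solution of the Navier–Stokes system (T. Tao, Anal. PDE 6 (2013) = arXiv:1108.1165, Thm. 5.4 (ii)
= arXiv Thm. 31 (ii), p. 18, with force; proof "by repeating the proof of Theorem 28 verbatim",
p. 16, and "the estimates for higher `k` follow from variants of the above argument and an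
induction on `k`"). Homogeneous twins: `FourierL2PicardEnvelope`, `FourierL2PicardWeighted`.

For the forced iterates `w_n = picardIterForced c T a b n` written `w_n = h − E_n`
(`h(t) = heat(clamp t) • a`, `E_0 = −F`, `E_{n+1} = duhamelIntegral c T w_n − F`,
`F = forcing c T b`) this file proves, under the smallness condition of
`picard_uniform_bounds_forced`:

* `exists_uniform_envelope_picardIterForced` — **`n`-uniform `λ`-free envelopes**: a finite `Λ` and,
  for every `n`, a measurable time-independent `Ψ_n` with `‖E_n(t, η)‖ₑ ≤ Ψ_n(η)` (all `t`) and
  `∫⁻((1+‖η‖)²Ψ_n)² ≤ Λ` (the homogeneous envelope `enorm_duhamelIntegral_hsub_le_psi` of the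
  Duhamel part, fed with the forced uniform `X¹/X²` bounds, plus the explicit envelope
  `T·B₄(1+‖η‖)^{-4}` of the forcing term);
* `exists_uniform_weighted_majorant_picardIterForced` — **uniform `e^{-λt}(1+‖ξ‖)^K`-weighted `L²`
  majorants of `E_n` of every order `K`**: `R_0 = R_F`,
  `R_{n+1} = μ((G₀ ⋆ₗ G_K) + (G_K ⋆ₗ G₀)) + R_F` with the forcing majorant
  `R_F = T·B_{K+2}(1+‖ξ‖)^{-2}`, Young's inequality and the choice `λ = 72 (C_N 2^K γ)²/c + 1`
  closing `∫⁻R_n² ≤ 2∫⁻((1+‖η‖)^K∑ⱼ‖aⱼ‖ₑ)² + 4∫⁻R_F²` for all `n`;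
* `exists_uniform_hasDecay_picardIterForced` — hence (Cauchy–Schwarz instead of Young, and
  `e^{λt} ≤ e^{λT}`) **pointwise polynomial decay of every order of `E_n`, uniformly in `n` and `t`**,
  the compactness used to pass to the limit (`ForcedFourierPicardLimit`).

On the physical side these are Tao's `‖u‖_{X^k([0,T])} ≲_{k, ‖u₀‖_{H^k}, ‖f‖_{L¹_tH^k_x}, 1}`
(arXiv Thm. 31 (ii)) for the approximating sequence of the FORCED Duhamel map. No definitions, no
named facts.

## Mathlib / tree search

Tree (reused as black boxes): `exp_weight_enorm_duhamelIntegral_hsub_le`,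
`lintegral_symm_lconv_sq_le`, `symm_lconv_le`, `lintegral_le_rpow_half_of_weight_sq_le`
(`FourierL2PicardWeighted`), `enorm_duhamelIntegral_hsub_le_psi`, `lintegral_weight_psi_sq_le`,
`measurable_psi` (`FourierL2PicardEnvelope`), `lintegral_sq_weight_Phi_hsub_le`,
`lintegral_fourth_weight_Phi_hsub_le` (`FourierL2PicardBounds`), `lintegral_weight_inv_sq_lt_top`,
`finrank_three_lt_four`, `HasDecay.enorm_le`; forced inputs `class_picardIterForced`,
`picard_uniform_bounds_forced` (`ForcedFourierPicardBounds`), `exists_hasDecay_forcing`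
(`ForcedFourierDuhamelForcing`).

## Wide class (the statements used by the forced existence theorem)

The primed theorems take the force coefficients in the WIDE class — `hbm : Measurable (uncurry b)`,
`hbt : ∀ ξ, Continuous fun s => b s ξ` and uniform decay — which is the class of the
Leray-projected transform of a Schwartz force (discontinuous at `ξ = 0`); they run through
`class_picardIterForced'` / `picard_uniform_bounds_forced'` and the primed black boxes of the
homogeneous chain. The unprimed statements (jointly continuous `b`) are their specialisations.

## References

* T. Tao, Anal. PDE 6 (2013) = arXiv:1108.1165, Thm. 5.4 (ii) = arXiv Thm. 31 (p. 18), proof of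
  Thm. 5.1 = arXiv Thm. 28 (p. 16). [Tao2011]
-/

noncomputable section

open MeasureTheory Real Set Filter Function intervalIntegral
open scoped ENNReal NNReal Convolution
open _root_.Topology

namespace Literature.Analysis.FluidPDE.FourierNS

variable {c T : ℝ} {a : EuclideanSpace ℝ (Fin 3) → Fin 3 → ℂ}
  {b : ℝ → EuclideanSpace ℝ (Fin 3) → Fin 3 → ℂ}

/-! ### Explicit envelopes of the forcing term -/

/-- Weight arithmetic: `w^k · (w^{k+m})⁻¹ = (w^m)⁻¹` for `w = 1 + ‖η‖`, in `ℝ≥0∞`. [folklore] -/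
private theorem weight_mul_inv_weight_add (k m : ℕ) (η : EuclideanSpace ℝ (Fin 3)) :
    ENNReal.ofReal ((1 + ‖η‖) ^ k) * (ENNReal.ofReal ((1 + ‖η‖) ^ (k + m)))⁻¹ =
      (ENNReal.ofReal ((1 + ‖η‖) ^ m))⁻¹ := by
  have hpos : ∀ n : ℕ, (0 : ℝ) < (1 + ‖η‖) ^ n := fun n => by positivity
  have hk0 : ENNReal.ofReal ((1 + ‖η‖) ^ k) ≠ 0 := (ENNReal.ofReal_pos.2 (hpos k)).ne'
  rw [pow_add, ENNReal.ofReal_mul (hpos k).le,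
    ENNReal.mul_inv (Or.inl hk0) (Or.inl ENNReal.ofReal_ne_top), ← mul_assoc,
    ENNReal.mul_inv_cancel hk0 ENNReal.ofReal_ne_top, one_mul]

/-- **Weighted envelope of the forcing term**: for `c, T ≥ 0` and force coefficients with decay
of every order there is `B ≥ 0` with
`(1+‖η‖)^k ‖F(t, η)‖ₑ ≤ B (1+‖η‖)^{-m}` for all `t`, `η` (decay of order `k + m` of `F`).
[cite: Tao2011, Lemma 2.1 (arXiv Lemma 23), (energy-duh2)] -/
theorem exists_weight_mul_enorm_forcing_le (hc : 0 ≤ c) (hT : 0 ≤ T)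
    (hbd : ∀ K : ℕ, ∃ B : ℝ, ∀ s, HasDecay K B (b s)) (k m : ℕ) :
    ∃ B : ℝ, 0 ≤ B ∧ ∀ t η, ENNReal.ofReal ((1 + ‖η‖) ^ k) * ‖forcing c T b t η‖ₑ ≤
      ENNReal.ofReal B * (ENNReal.ofReal ((1 + ‖η‖) ^ m))⁻¹ := by
  obtain ⟨B, hB⟩ := exists_hasDecay_forcing (c := c) hc hT hbd (k + m)
  refine ⟨B, (hB 0).nonneg, fun t η => ?_⟩
  calc ENNReal.ofReal ((1 + ‖η‖) ^ k) * ‖forcing c T b t η‖ₑ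
      ≤ ENNReal.ofReal ((1 + ‖η‖) ^ k) * (ENNReal.ofReal B *
          (ENNReal.ofReal ((1 + ‖η‖) ^ (k + m)))⁻¹) := mul_le_mul' le_rfl ((hB t).enorm_le η)
    _ = ENNReal.ofReal B * (ENNReal.ofReal ((1 + ‖η‖) ^ k) *
          (ENNReal.ofReal ((1 + ‖η‖) ^ (k + m)))⁻¹) := by ring
    _ = ENNReal.ofReal B * (ENNReal.ofReal ((1 + ‖η‖) ^ m))⁻¹ := by
        rw [weight_mul_inv_weight_add]

/-- The explicit envelope `B (1+‖η‖)^{-m}` is measurable. [folklore] -/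
private theorem measurable_decayProfile (B : ℝ) (m : ℕ) :
    Measurable fun η : EuclideanSpace ℝ (Fin 3) =>
      ENNReal.ofReal B * (ENNReal.ofReal ((1 + ‖η‖) ^ m))⁻¹ :=
  ((measurable_ofReal_weight m).inv).const_mul _

/-- The explicit envelope `B (1+‖η‖)^{-2}` is square integrable on `ℝ³`:
`∫⁻ (B w^{-2})² = B² ∫⁻ w^{-4} < ∞`. [folklore] -/
private theorem lintegral_decayProfile_two_sq_lt_top (B : ℝ) :
    ∫⁻ η : EuclideanSpace ℝ (Fin 3), (ENNReal.ofReal B * (ENNReal.ofReal ((1 + ‖η‖) ^ 2))⁻¹) ^ 2 < ⊤ := by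
  have h : ∫⁻ η : EuclideanSpace ℝ (Fin 3), (ENNReal.ofReal B * (ENNReal.ofReal ((1 + ‖η‖) ^ 2))⁻¹) ^ 2 =
      ENNReal.ofReal B ^ 2 * ∫⁻ η : EuclideanSpace ℝ (Fin 3), (ENNReal.ofReal ((1 + ‖η‖) ^ 2))⁻¹ ^ 2 := by
    rw [← lintegral_const_mul' _ _ (ENNReal.pow_ne_top ENNReal.ofReal_ne_top)]
    exact lintegral_congr fun η => by rw [mul_pow]
  rw [h]
  exact ENNReal.mul_lt_top (ENNReal.pow_lt_top ENNReal.ofReal_lt_top)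
    (lintegral_weight_inv_sq_lt_top finrank_three_lt_four)

/-! ### Uniform `λ`-free envelopes along the forced iteration -/

/-- **`n`-uniform `λ`-free envelopes of the Duhamel parts of the forced Picard iterates.** Under
the hypotheses of `picard_uniform_bounds_forced` (with finite sizes `δ₁, δ₂`), there is a finite
`Λ` such that every `E_n = h − picardIterForced c T a b n` admits a measurable, time-independent
envelope `‖E_n(t, η)‖ₑ ≤ Ψ_n(η)` (all `t ∈ ℝ`) with `∫⁻ ((1+‖η‖)² Ψ_n)² ≤ Λ`
(`Ψ_0 = Ψ_F`, the envelope of the forcing term; `Ψ_{n+1} = Ψ_duh + Ψ_F` with the homogeneous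
envelope `enorm_duhamelIntegral_hsub_le_psi` of `duhamelIntegral c T w_n`, controlled through
`lintegral_weight_psi_sq_le` by the forced uniform bounds `I₁ ≤ 256C²K₃²θδ₁²`,
`I₂ ≤ 1024C²K₃²θδ₁δ₂`). [cite: Tao2011, Thm. 5.4 (ii) (arXiv Thm. 31), proof of Thm. 5.1 (arXiv p. 16)]
Twin for the wide (jointly measurable, time-continuous at each frequency) class of `E`. -/
theorem exists_uniform_envelope_picardIterForced' (hc : 0 < c) (hT : 0 ≤ T)
    (ha : AEStronglyMeasurable a volume)
    (haw : ∀ (k : ℕ) j, ∫⁻ η, (ENNReal.ofReal ((1 + ‖η‖) ^ k) * ‖a η j‖ₑ) ^ 2 < ⊤)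
    (hbm : Measurable (uncurry b)) (hbt : ∀ ξ, Continuous fun s => b s ξ) (hbd : ∀ K : ℕ, ∃ B : ℝ, ∀ s, HasDecay K B (b s))
    {δ₁ δ₂ : ℝ≥0∞} (hδ₁ : δ₁ < ⊤) (hδ₂ : δ₂ < ⊤)
    (hα₁ : ∫⁻ η, (ENNReal.ofReal ‖η‖ * ∑ j, ‖a η j‖ₑ) ^ 2 ≤ δ₁)
    (hα₂ : ∫⁻ η, (ENNReal.ofReal (‖η‖ ^ 2) * ∑ j, ‖a η j‖ₑ) ^ 2 ≤ δ₂)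
    (hF₁ : ∀ t ∈ Icc 0 T, ∫⁻ η, (ENNReal.ofReal ‖η‖ * ∑ j, ‖forcing c T b t η j‖ₑ) ^ 2 ≤ δ₁)
    (hG₁ : ∫⁻ t in Ioc 0 T, ∫⁻ η, (ENNReal.ofReal (‖η‖ ^ 2) *
      ∑ j, ‖forcing c T b t η j‖ₑ) ^ 2 ≤ ENNReal.ofReal c⁻¹ * δ₁)
    (hF₂ : ∀ t ∈ Icc 0 T, ∫⁻ η, (ENNReal.ofReal (‖η‖ ^ 2) * ∑ j, ‖forcing c T b t η j‖ₑ) ^ 2 ≤ δ₂)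
    (hG₂ : ∫⁻ t in Ioc 0 T, ∫⁻ η, (ENNReal.ofReal (‖η‖ ^ 3) *
      ∑ j, ‖forcing c T b t η j‖ₑ) ^ 2 ≤ ENNReal.ofReal c⁻¹ * δ₂)
    (hs : 36864 * (ENNReal.ofReal (4 * π) * (Fintype.card (Fin 3) : ℝ≥0∞) ^ 2) ^ 2 *
        ((SNormLESNormFDerivOfEqConst ℂ (volume : Measure (EuclideanSpace ℝ (Fin 3))) 2 *
          ENNReal.ofReal (2 * π)) ^ (3 / 2 : ℝ)) ^ 2 * ENNReal.ofReal c⁻¹ *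
        (ENNReal.ofReal T * ENNReal.ofReal c⁻¹) ^ (1 / 2 : ℝ) * δ₁ ≤ 1) :
    ∃ Λ : ℝ≥0∞, Λ < ⊤ ∧ ∀ n : ℕ, ∃ Ψ : EuclideanSpace ℝ (Fin 3) → ℝ≥0∞, Measurable Ψ ∧
      (∀ t η, ‖heat c η (clamp T t) • a η - picardIterForced c T a b n t η‖ₑ ≤ Ψ η) ∧
      ∫⁻ η, (ENNReal.ofReal ((1 + ‖η‖) ^ 2) * Ψ η) ^ 2 ≤ Λ := by
  set C : ℝ≥0∞ := ENNReal.ofReal (4 * π) * (Fintype.card (Fin 3) : ℝ≥0∞) ^ 2 with hC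
  set K3 : ℝ≥0∞ := (SNormLESNormFDerivOfEqConst ℂ (volume : Measure (EuclideanSpace ℝ (Fin 3))) 2 *
    ENNReal.ofReal (2 * π)) ^ (3 / 2 : ℝ) with hK3
  have hCtop : C < ⊤ := ENNReal.mul_lt_top ENNReal.ofReal_lt_top (by simp)
  have hK3top : K3 < ⊤ :=
    ENNReal.rpow_lt_top_of_nonneg (by norm_num) (ENNReal.mul_ne_top ENNReal.coe_ne_top ENNReal.ofReal_ne_top)
  have hrt : ∀ {x : ℝ≥0∞}, x < ⊤ → x ^ (1 / 2 : ℝ) < ⊤ := fun h =>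
    ENNReal.rpow_lt_top_of_nonneg (by norm_num) h.ne
  -- the envelope of the forcing term (order `0 + 4`)
  obtain ⟨BF, hBF0, hBF⟩ := exists_weight_mul_enorm_forcing_le (c := c) hc.le hT hbd 0 4
  set ΨF : EuclideanSpace ℝ (Fin 3) → ℝ≥0∞ := fun η =>
    ENNReal.ofReal BF * (ENNReal.ofReal ((1 + ‖η‖) ^ 4))⁻¹ with hΨF
  have hΨFm : Measurable ΨF := measurable_decayProfile BF 4
  have hΨFb : ∀ t η, ‖forcing c T b t η‖ₑ ≤ ΨF η := fun t η => by
    have h := hBF t η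
    simpa only [pow_zero, ENNReal.ofReal_one, one_mul] using h
  set ΛF : ℝ≥0∞ := ∫⁻ η, (ENNReal.ofReal ((1 + ‖η‖) ^ 2) * ΨF η) ^ 2 with hΛF
  have hΛFeq : ∀ η, ENNReal.ofReal ((1 + ‖η‖) ^ 2) * ΨF η =
      ENNReal.ofReal BF * (ENNReal.ofReal ((1 + ‖η‖) ^ 2))⁻¹ := fun η => by
    rw [hΨF]
    calc ENNReal.ofReal ((1 + ‖η‖) ^ 2) * (ENNReal.ofReal BF * (ENNReal.ofReal ((1 + ‖η‖) ^ 4))⁻¹)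
        = ENNReal.ofReal BF * (ENNReal.ofReal ((1 + ‖η‖) ^ 2) *
            (ENNReal.ofReal ((1 + ‖η‖) ^ (2 + 2)))⁻¹) := by ring_nf
      _ = _ := by rw [weight_mul_inv_weight_add]
  have hΛFtop : ΛF < ⊤ := by
    have h : ΛF = ∫⁻ η : EuclideanSpace ℝ (Fin 3),
        (ENNReal.ofReal BF * (ENNReal.ofReal ((1 + ‖η‖) ^ 2))⁻¹) ^ 2 :=
      lintegral_congr fun η => by rw [hΛFeq]
    rw [h]; exact lintegral_decayProfile_two_sq_lt_top BF
  -- the uniform `I₁`, `I₂` bounds of the forced iteration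
  set θ : ℝ≥0∞ := (ENNReal.ofReal T * ENNReal.ofReal c⁻¹) ^ (1 / 2 : ℝ) with hθ
  have hθtop : θ < ⊤ := hrt (ENNReal.mul_lt_top ENNReal.ofReal_lt_top ENNReal.ofReal_lt_top)
  set J₁ : ℝ≥0∞ := 4 * C ^ 2 * K3 ^ 2 * ((8 * δ₁) ^ (1 / 2 : ℝ) * (8 * δ₁) *
    (ENNReal.ofReal T * (8 * ENNReal.ofReal c⁻¹ * δ₁)) ^ (1 / 2 : ℝ)) with hJ₁
  set J₂ : ℝ≥0∞ := 16 * C ^ 2 * K3 ^ 2 * ((8 * δ₂) ^ (1 / 2 : ℝ) * (8 * δ₁) *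
    (ENNReal.ofReal T * (8 * ENNReal.ofReal c⁻¹ * δ₂)) ^ (1 / 2 : ℝ)) with hJ₂
  have h8 : ∀ {x : ℝ≥0∞}, x < ⊤ → 8 * x < ⊤ := fun h => ENNReal.mul_lt_top (by norm_num) h
  have hJ₁top : J₁ < ⊤ := by
    refine ENNReal.mul_lt_top (ENNReal.mul_lt_top (ENNReal.mul_lt_top (by norm_num)
      (ENNReal.pow_lt_top hCtop)) (ENNReal.pow_lt_top hK3top)) ?_
    exact ENNReal.mul_lt_top (ENNReal.mul_lt_top (hrt (h8 hδ₁)) (h8 hδ₁))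
      (hrt (ENNReal.mul_lt_top ENNReal.ofReal_lt_top (ENNReal.mul_lt_top (h8 ENNReal.ofReal_lt_top) hδ₁)))
  have hJ₂top : J₂ < ⊤ := by
    refine ENNReal.mul_lt_top (ENNReal.mul_lt_top (ENNReal.mul_lt_top (by norm_num)
      (ENNReal.pow_lt_top hCtop)) (ENNReal.pow_lt_top hK3top)) ?_
    exact ENNReal.mul_lt_top (ENNReal.mul_lt_top (hrt (h8 hδ₂)) (h8 hδ₁))
      (hrt (ENNReal.mul_lt_top ENNReal.ofReal_lt_top (ENNReal.mul_lt_top (h8 ENNReal.ofReal_lt_top) hδ₂)))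
  set Λduh : ℝ≥0∞ := 8 * (ENNReal.ofReal T * J₁ + ENNReal.ofReal (1 / (2 * c)) * J₂) with hΛduh
  have hΛduhtop : Λduh < ⊤ :=
    ENNReal.mul_lt_top (by norm_num) (ENNReal.add_lt_top.2
      ⟨ENNReal.mul_lt_top ENNReal.ofReal_lt_top hJ₁top, ENNReal.mul_lt_top ENNReal.ofReal_lt_top hJ₂top⟩)
  have hsq : ∀ x y : ℝ≥0∞, (x + y) ^ 2 ≤ 2 * x ^ 2 + 2 * y ^ 2 := fun x y => by
    have h := ENNReal.rpow_add_le_mul_rpow_add_rpow x y (p := 2) (by norm_num)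
    norm_num at h
    rw [← mul_add]
    exact_mod_cast h
  refine ⟨2 * Λduh + 2 * ΛF, ?_, fun n => ?_⟩
  · exact ENNReal.add_lt_top.2 ⟨ENNReal.mul_lt_top (by norm_num) hΛduhtop,
      ENNReal.mul_lt_top (by norm_num) hΛFtop⟩
  cases n with
  | zero =>
    refine ⟨ΨF, hΨFm, fun t η => ?_, ?_⟩
    · have h0 : heat c η (clamp T t) • a η - picardIterForced c T a b 0 t η = -forcing c T b t η := by
        simp only [picardIterForced_zero]
        exact sub_add_cancel_left _ _
      rw [h0, enorm_neg]
      exact hΨFb t η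
    · calc ΛF ≤ 2 * ΛF := by
            calc ΛF = 1 * ΛF := (one_mul _).symm
              _ ≤ 2 * ΛF := mul_le_mul' (by norm_num) le_rfl
        _ ≤ 2 * Λduh + 2 * ΛF := le_add_self
  | succ n =>
    set En : ℝ → EuclideanSpace ℝ (Fin 3) → Fin 3 → ℂ :=
      fun t ξ => heat c ξ (clamp T t) • a ξ - picardIterForced c T a b n t ξ with hEn
    have hvn : (fun s η => heat c η (clamp T s) • a η - En s η) = picardIterForced c T a b n := by
      funext s η; simp [hEn]
    have hstep : ∀ t ξ, heat c ξ (clamp T t) • a ξ - picardIterForced c T a b (n + 1) t ξ =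
        duhamelIntegral c T (fun s η => heat c η (clamp T s) • a η - En s η) t ξ -
          forcing c T b t ξ := by
      intro t ξ
      rw [hvn, picardIterForced_succ, duhamelForced_eq_sub]
      abel
    obtain ⟨-, hEm, hEt, hEd⟩ := class_picardIterForced' hc.le hT ha haw hbm hbt hbd n
    obtain ⟨hA, hP, hB, hE⟩ := picard_uniform_bounds_forced' hc hT ha haw hbm hbt hbd hα₁ hα₂ hF₁ hG₁
      hF₂ hG₂ hs n
    have hA' : ∀ s ∈ Icc 0 T, ∫⁻ η, (ENNReal.ofReal ‖η‖ *
        ∑ j, ‖(heat c η (clamp T s) • a η - En s η) j‖ₑ) ^ 2 ≤ 8 * δ₁ := fun s hs => by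
      simpa only [hEn, sub_sub_cancel] using hA s hs
    have hP' : ∫⁻ s in Ioc 0 T, ∫⁻ η, (ENNReal.ofReal (‖η‖ ^ 2) *
        ∑ j, ‖(heat c η (clamp T s) • a η - En s η) j‖ₑ) ^ 2 ≤ 8 * ENNReal.ofReal c⁻¹ * δ₁ := by
      simpa only [hEn, sub_sub_cancel] using hP
    have hB' : ∀ s ∈ Icc 0 T, ∫⁻ η, (ENNReal.ofReal (‖η‖ ^ 2) *
        ∑ j, ‖(heat c η (clamp T s) • a η - En s η) j‖ₑ) ^ 2 ≤ 8 * δ₂ := fun s hs => by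
      simpa only [hEn, sub_sub_cancel] using hB s hs
    have hE' : ∫⁻ s in Ioc 0 T, ∫⁻ η, (ENNReal.ofReal (‖η‖ ^ 3) *
        ∑ j, ‖(heat c η (clamp T s) • a η - En s η) j‖ₑ) ^ 2 ≤ 8 * ENNReal.ofReal c⁻¹ * δ₂ := by
      simpa only [hEn, sub_sub_cancel] using hE
    have hI₁ := lintegral_sq_weight_Phi_hsub_le' hc ha haw hEm hEt hEd hA' hP'
    have hI₂ := lintegral_fourth_weight_Phi_hsub_le' hc ha haw hEm hEt hEd hA' hB' hE'
    set Ψduh := fun η : EuclideanSpace ℝ (Fin 3) =>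
      (min (ENNReal.ofReal (1 / (2 * c))) (ENNReal.ofReal (‖η‖ ^ 2 * T)) *
        ∫⁻ s in Ioc 0 T, (ENNReal.ofReal (4 * π) * (Fintype.card (Fin 3) : ℝ≥0∞) ^ 2 *
          ‖fconv (fun ζ => ((∑ j, ‖(heat c ζ (clamp T s) • a ζ - En s ζ) j‖ : ℝ) : ℂ))
            (fun ζ => ((∑ j, ‖(heat c ζ (clamp T s) • a ζ - En s ζ) j‖ : ℝ) : ℂ)) η‖ₑ) ^ 2) ^
        (1 / 2 : ℝ) with hΨduh
    have hΨduhm : Measurable Ψduh := measurable_psi' (T := T) hc ha haw hEm hEt hEd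
    refine ⟨fun η => Ψduh η + ΨF η, hΨduhm.add hΨFm, fun t η => ?_, ?_⟩
    · rw [hstep]
      refine (enorm_sub_le).trans (add_le_add ?_ (hΨFb t η))
      exact enorm_duhamelIntegral_hsub_le_psi' hc hT ha haw hEm hEt hEd t η
    · have hm1 : AEMeasurable (fun η => 2 * (ENNReal.ofReal ((1 + ‖η‖) ^ 2) * Ψduh η) ^ 2) volume :=
        ((((measurable_ofReal_weight 2).mul hΨduhm).pow_const 2).const_mul _).aemeasurable
      calc ∫⁻ η, (ENNReal.ofReal ((1 + ‖η‖) ^ 2) * (Ψduh η + ΨF η)) ^ 2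
          ≤ ∫⁻ η, (2 * (ENNReal.ofReal ((1 + ‖η‖) ^ 2) * Ψduh η) ^ 2 +
              2 * (ENNReal.ofReal ((1 + ‖η‖) ^ 2) * ΨF η) ^ 2) := by
            refine lintegral_mono fun η => ?_
            rw [mul_add]
            exact hsq _ _
        _ = 2 * (∫⁻ η, (ENNReal.ofReal ((1 + ‖η‖) ^ 2) * Ψduh η) ^ 2) + 2 * ΛF := by
            rw [lintegral_add_left' hm1, lintegral_const_mul' _ _ (by norm_num),
              lintegral_const_mul' _ _ (by norm_num)]
        _ ≤ 2 * Λduh + 2 * ΛF := by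
            refine add_le_add (mul_le_mul' le_rfl ?_) le_rfl
            refine (lintegral_weight_psi_sq_le' (T := T) hc ha haw hEm hEt hEd).trans ?_
            exact mul_le_mul' le_rfl (add_le_add (mul_le_mul' le_rfl hI₁) (mul_le_mul' le_rfl hI₂))

/-- **`n`-uniform `λ`-free envelopes of the Duhamel parts of the forced Picard iterates.** Under
the hypotheses of `picard_uniform_bounds_forced` (with finite sizes `δ₁, δ₂`), there is a finite
`Λ` such that every `E_n = h − picardIterForced c T a b n` admits a measurable, time-independent
envelope `‖E_n(t, η)‖ₑ ≤ Ψ_n(η)` (all `t ∈ ℝ`) with `∫⁻ ((1+‖η‖)² Ψ_n)² ≤ Λ`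
(`Ψ_0 = Ψ_F`, the envelope of the forcing term; `Ψ_{n+1} = Ψ_duh + Ψ_F` with the homogeneous
envelope `enorm_duhamelIntegral_hsub_le_psi` of `duhamelIntegral c T w_n`, controlled through
`lintegral_weight_psi_sq_le` by the forced uniform bounds `I₁ ≤ 256C²K₃²θδ₁²`,
`I₂ ≤ 1024C²K₃²θδ₁δ₂`). [cite: Tao2011, Thm. 5.4 (ii) (arXiv Thm. 31), proof of Thm. 5.1 (arXiv p. 16)] -/
theorem exists_uniform_envelope_picardIterForced (hc : 0 < c) (hT : 0 ≤ T)
    (ha : AEStronglyMeasurable a volume)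
    (haw : ∀ (k : ℕ) j, ∫⁻ η, (ENNReal.ofReal ((1 + ‖η‖) ^ k) * ‖a η j‖ₑ) ^ 2 < ⊤)
    (hbc : Continuous (uncurry b)) (hbd : ∀ K : ℕ, ∃ B : ℝ, ∀ s, HasDecay K B (b s))
    {δ₁ δ₂ : ℝ≥0∞} (hδ₁ : δ₁ < ⊤) (hδ₂ : δ₂ < ⊤)
    (hα₁ : ∫⁻ η, (ENNReal.ofReal ‖η‖ * ∑ j, ‖a η j‖ₑ) ^ 2 ≤ δ₁)
    (hα₂ : ∫⁻ η, (ENNReal.ofReal (‖η‖ ^ 2) * ∑ j, ‖a η j‖ₑ) ^ 2 ≤ δ₂)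
    (hF₁ : ∀ t ∈ Icc 0 T, ∫⁻ η, (ENNReal.ofReal ‖η‖ * ∑ j, ‖forcing c T b t η j‖ₑ) ^ 2 ≤ δ₁)
    (hG₁ : ∫⁻ t in Ioc 0 T, ∫⁻ η, (ENNReal.ofReal (‖η‖ ^ 2) *
      ∑ j, ‖forcing c T b t η j‖ₑ) ^ 2 ≤ ENNReal.ofReal c⁻¹ * δ₁)
    (hF₂ : ∀ t ∈ Icc 0 T, ∫⁻ η, (ENNReal.ofReal (‖η‖ ^ 2) * ∑ j, ‖forcing c T b t η j‖ₑ) ^ 2 ≤ δ₂)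
    (hG₂ : ∫⁻ t in Ioc 0 T, ∫⁻ η, (ENNReal.ofReal (‖η‖ ^ 3) *
      ∑ j, ‖forcing c T b t η j‖ₑ) ^ 2 ≤ ENNReal.ofReal c⁻¹ * δ₂)
    (hs : 36864 * (ENNReal.ofReal (4 * π) * (Fintype.card (Fin 3) : ℝ≥0∞) ^ 2) ^ 2 *
        ((SNormLESNormFDerivOfEqConst ℂ (volume : Measure (EuclideanSpace ℝ (Fin 3))) 2 *
          ENNReal.ofReal (2 * π)) ^ (3 / 2 : ℝ)) ^ 2 * ENNReal.ofReal c⁻¹ *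
        (ENNReal.ofReal T * ENNReal.ofReal c⁻¹) ^ (1 / 2 : ℝ) * δ₁ ≤ 1) :
    ∃ Λ : ℝ≥0∞, Λ < ⊤ ∧ ∀ n : ℕ, ∃ Ψ : EuclideanSpace ℝ (Fin 3) → ℝ≥0∞, Measurable Ψ ∧
      (∀ t η, ‖heat c η (clamp T t) • a η - picardIterForced c T a b n t η‖ₑ ≤ Ψ η) ∧
      ∫⁻ η, (ENNReal.ofReal ((1 + ‖η‖) ^ 2) * Ψ η) ^ 2 ≤ Λ :=
  exists_uniform_envelope_picardIterForced' hc hT ha haw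
    hbc.measurable (fun ξ => hbc.uncurry_right ξ) hbd hδ₁ hδ₂ hα₁ hα₂ hF₁ hG₁ hF₂ hG₂ hs

/-! ### The recursion: uniform weighted `L²` majorants of all orders -/

/-- **Uniform weighted majorants of the Duhamel parts of the forced Picard iterates, every
order.** Under the hypotheses of `picard_uniform_bounds_forced` (finite `δ₁, δ₂`) and for every `K`,
there are `λ > 0` and a finite `β` such that every `E_n = h − picardIterForced c T a b n` admits a
measurable `R_n` with `∫⁻ R_n² ≤ β` and `e^{-λt}(1+‖ξ‖)^K ‖E_n(t, ξ)‖ₑ ≤ R_n(ξ)` for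
`t ∈ [0, T]` (`R_0 = R_F = T·B_{K+2}(1+‖ξ‖)^{-2}` the weighted envelope of the forcing term,
`R_{n+1} = μ((G₀ ⋆ₗ G_K) + (G_K ⋆ₗ G₀)) + R_F`, Young, and the choice `λ = 72 (C_N 2^K γ)²/c + 1`,
`γ ≥ ‖G₀‖_{L¹}` uniformly, `β = 2∫⁻((1+‖η‖)^K∑ⱼ‖aⱼ‖ₑ)² + 4∫⁻R_F²`). This is the
`L^∞_t H^K_x`-type bound "`‖u‖_{X^k} ≲_{k, ‖u₀‖_{H^k}, ‖f‖_{L¹_tH^k_x}, 1}`" of Thm. 5.4 (ii) for the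
approximating sequence of the forced Duhamel map, in exponentially time-weighted form.
[cite: Tao2011, Thm. 5.4 (ii) (arXiv Thm. 31), proof of Thm. 5.1 (arXiv Thm. 28, p. 16)]
Twin for the wide (jointly measurable, time-continuous at each frequency) class of `E`. -/
theorem exists_uniform_weighted_majorant_picardIterForced' (hc : 0 < c) (hT : 0 ≤ T)
    (ha : AEStronglyMeasurable a volume)
    (haw : ∀ (k : ℕ) j, ∫⁻ η, (ENNReal.ofReal ((1 + ‖η‖) ^ k) * ‖a η j‖ₑ) ^ 2 < ⊤)
    (hbm : Measurable (uncurry b)) (hbt : ∀ ξ, Continuous fun s => b s ξ) (hbd : ∀ K : ℕ, ∃ B : ℝ, ∀ s, HasDecay K B (b s))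
    {δ₁ δ₂ : ℝ≥0∞} (hδ₁ : δ₁ < ⊤) (hδ₂ : δ₂ < ⊤)
    (hα₁ : ∫⁻ η, (ENNReal.ofReal ‖η‖ * ∑ j, ‖a η j‖ₑ) ^ 2 ≤ δ₁)
    (hα₂ : ∫⁻ η, (ENNReal.ofReal (‖η‖ ^ 2) * ∑ j, ‖a η j‖ₑ) ^ 2 ≤ δ₂)
    (hF₁ : ∀ t ∈ Icc 0 T, ∫⁻ η, (ENNReal.ofReal ‖η‖ * ∑ j, ‖forcing c T b t η j‖ₑ) ^ 2 ≤ δ₁)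
    (hG₁ : ∫⁻ t in Ioc 0 T, ∫⁻ η, (ENNReal.ofReal (‖η‖ ^ 2) *
      ∑ j, ‖forcing c T b t η j‖ₑ) ^ 2 ≤ ENNReal.ofReal c⁻¹ * δ₁)
    (hF₂ : ∀ t ∈ Icc 0 T, ∫⁻ η, (ENNReal.ofReal (‖η‖ ^ 2) * ∑ j, ‖forcing c T b t η j‖ₑ) ^ 2 ≤ δ₂)
    (hG₂ : ∫⁻ t in Ioc 0 T, ∫⁻ η, (ENNReal.ofReal (‖η‖ ^ 3) *
      ∑ j, ‖forcing c T b t η j‖ₑ) ^ 2 ≤ ENNReal.ofReal c⁻¹ * δ₂)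
    (hs : 36864 * (ENNReal.ofReal (4 * π) * (Fintype.card (Fin 3) : ℝ≥0∞) ^ 2) ^ 2 *
        ((SNormLESNormFDerivOfEqConst ℂ (volume : Measure (EuclideanSpace ℝ (Fin 3))) 2 *
          ENNReal.ofReal (2 * π)) ^ (3 / 2 : ℝ)) ^ 2 * ENNReal.ofReal c⁻¹ *
        (ENNReal.ofReal T * ENNReal.ofReal c⁻¹) ^ (1 / 2 : ℝ) * δ₁ ≤ 1) (K : ℕ) :
    ∃ lam : ℝ, 0 < lam ∧ ∃ β : ℝ≥0∞, β < ⊤ ∧ ∀ n : ℕ,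
      ∃ R : EuclideanSpace ℝ (Fin 3) → ℝ≥0∞, AEMeasurable R volume ∧ ∫⁻ ξ, R ξ ^ 2 ≤ β ∧
        ∀ t ∈ Icc 0 T, ∀ ξ, ENNReal.ofReal (Real.exp (-lam * t) * (1 + ‖ξ‖) ^ K) *
          ‖heat c ξ (clamp T t) • a ξ - picardIterForced c T a b n t ξ‖ₑ ≤ R ξ := by
  obtain ⟨Λ, hΛ, hΨ⟩ := exists_uniform_envelope_picardIterForced' hc hT ha haw hbm hbt hbd hδ₁ hδ₂ hα₁ hα₂
    hF₁ hG₁ hF₂ hG₂ hs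
  set C : ℝ≥0∞ := ENNReal.ofReal (4 * π) * (Fintype.card (Fin 3) : ℝ≥0∞) ^ 2 with hC
  have hCtop : C < ⊤ := ENNReal.mul_lt_top ENNReal.ofReal_lt_top (by simp)
  set Amaj : EuclideanSpace ℝ (Fin 3) → ℝ≥0∞ := fun η => ∑ j, ‖a η j‖ₑ with hAmaj
  have hAm : AEMeasurable Amaj volume := aemeasurable_majorant ha
  -- data constants
  set W2 : ℝ≥0∞ := ∫⁻ ξ : EuclideanSpace ℝ (Fin 3), (ENNReal.ofReal ((1 + ‖ξ‖) ^ 2))⁻¹ ^ 2 with hW2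
  have hW2top : W2 < ⊤ := lintegral_weight_inv_sq_lt_top finrank_three_lt_four
  set αw2 : ℝ≥0∞ := ∫⁻ η, (ENNReal.ofReal ((1 + ‖η‖) ^ 2) * Amaj η) ^ 2 with hαw2
  set αwK : ℝ≥0∞ := ∫⁻ η, (ENNReal.ofReal ((1 + ‖η‖) ^ K) * Amaj η) ^ 2 with hαwK
  have hαwKtop : αwK < ⊤ := lintegral_weight_majorant_sq_lt_top ha K (haw K)
  have hrt : ∀ {x : ℝ≥0∞}, x < ⊤ → x ^ (1 / 2 : ℝ) < ⊤ := fun h =>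
    ENNReal.rpow_lt_top_of_nonneg (by norm_num) h.ne
  -- the weighted majorant of the forcing term (order `K + 2`)
  obtain ⟨BF, hBF0, hBF⟩ := exists_weight_mul_enorm_forcing_le (c := c) hc.le hT hbd K 2
  set RF : EuclideanSpace ℝ (Fin 3) → ℝ≥0∞ := fun η =>
    ENNReal.ofReal BF * (ENNReal.ofReal ((1 + ‖η‖) ^ 2))⁻¹ with hRF
  have hRFm : AEMeasurable RF volume := (measurable_decayProfile BF 2).aemeasurable
  set ρF : ℝ≥0∞ := ∫⁻ η, RF η ^ 2 with hρF
  have hρFtop : ρF < ⊤ := lintegral_decayProfile_two_sq_lt_top BF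
  -- the uniform `L¹` bound of `G₀ = Amaj + 3Ψ`
  set γ : ℝ≥0∞ := (W2 * αw2) ^ (1 / 2 : ℝ) + 3 * (W2 * Λ) ^ (1 / 2 : ℝ) with hγ
  have hγtop : γ < ⊤ :=
    ENNReal.add_lt_top.2 ⟨hrt (ENNReal.mul_lt_top hW2top (lintegral_weight_majorant_sq_lt_top ha 2 (haw 2))),
      ENNReal.mul_lt_top (by norm_num) (hrt (ENNReal.mul_lt_top hW2top hΛ))⟩
  have hG₀L1 : ∀ {Ψ : EuclideanSpace ℝ (Fin 3) → ℝ≥0∞}, Measurable Ψ →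
      ∫⁻ η, (ENNReal.ofReal ((1 + ‖η‖) ^ 2) * Ψ η) ^ 2 ≤ Λ → ∫⁻ η, (Amaj η + 3 * Ψ η) ≤ γ := by
    intro Ψ hΨm hΨΛ
    rw [lintegral_add_left' hAm, lintegral_const_mul' _ _ (by norm_num)]
    exact add_le_add (lintegral_le_rpow_half_of_weight_sq_le hAm 2 le_rfl)
      (mul_le_mul' le_rfl (lintegral_le_rpow_half_of_weight_sq_le hΨm.aemeasurable 2 hΨΛ))
  -- the choice of `λ`
  set X : ℝ≥0∞ := (C * 2 ^ K) ^ 2 * γ ^ 2 with hX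
  have hXtop : X < ⊤ := ENNReal.mul_lt_top (ENNReal.pow_lt_top (ENNReal.mul_lt_top hCtop
    (ENNReal.pow_lt_top (by simp)))) (ENNReal.pow_lt_top hγtop)
  set lam : ℝ := 72 * X.toReal / c + 1 with hlam
  have hlam0 : 0 < lam := by positivity
  set μ : ℝ≥0∞ := ENNReal.ofReal (1 / (2 * Real.sqrt (c * lam))) * (C * 2 ^ K) with hμ
  have hkey : 288 * (μ ^ 2 * γ ^ 2) ≤ 1 := by
    have hsq : ENNReal.ofReal (1 / (2 * Real.sqrt (c * lam))) ^ 2 = ENNReal.ofReal (1 / (4 * (c * lam))) := by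
      rw [← ENNReal.ofReal_pow (by positivity), div_pow, mul_pow, Real.sq_sqrt (by positivity)]
      norm_num
    have h1 : μ ^ 2 * γ ^ 2 = ENNReal.ofReal (1 / (4 * (c * lam))) * X := by
      rw [hμ, mul_pow, hsq, hX]; ring
    have h2 : (288 : ℝ≥0∞) * ENNReal.ofReal (1 / (4 * (c * lam))) = ENNReal.ofReal (72 / (c * lam)) := by
      rw [show (288 : ℝ≥0∞) = ENNReal.ofReal 288 by norm_num, ← ENNReal.ofReal_mul (by norm_num)]
      congr 1
      field_simp
      norm_num
    have hcl : c * lam = 72 * X.toReal + c := by rw [hlam]; field_simp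
    calc 288 * (μ ^ 2 * γ ^ 2) = ENNReal.ofReal (72 / (c * lam)) * X := by rw [h1, ← mul_assoc, h2]
      _ = ENNReal.ofReal (72 / (c * lam) * X.toReal) := by
          rw [ENNReal.ofReal_mul (by positivity), ENNReal.ofReal_toReal hXtop.ne]
      _ ≤ ENNReal.ofReal 1 := by
          refine ENNReal.ofReal_le_ofReal ?_
          rw [div_mul_eq_mul_div, div_le_one (by positivity), hcl]
          linarith
      _ = 1 := ENNReal.ofReal_one
  set β' : ℝ≥0∞ := αwK + 2 * ρF with hβ'
  have hβ'top : β' < ⊤ := ENNReal.add_lt_top.2 ⟨hαwKtop, ENNReal.mul_lt_top (by norm_num) hρFtop⟩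
  have hsq2 : ∀ x y : ℝ≥0∞, (x + y) ^ 2 ≤ 2 * x ^ 2 + 2 * y ^ 2 := fun x y => by
    have h := ENNReal.rpow_add_le_mul_rpow_add_rpow x y (p := 2) (by norm_num)
    norm_num at h
    rw [← mul_add]
    exact_mod_cast h
  refine ⟨lam, hlam0, 2 * β', ENNReal.mul_lt_top (by norm_num) hβ'top, fun n => ?_⟩
  induction n with
  | zero =>
    refine ⟨RF, hRFm, ?_, fun t ht ξ => ?_⟩
    · calc ρF ≤ 2 * ρF := by
            calc ρF = 1 * ρF := (one_mul _).symm
              _ ≤ 2 * ρF := mul_le_mul' (by norm_num) le_rfl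
        _ ≤ αwK + 2 * ρF := le_add_self
        _ ≤ 2 * β' := by
            calc β' = 1 * β' := (one_mul _).symm
              _ ≤ 2 * β' := mul_le_mul' (by norm_num) le_rfl
    · have h0 : heat c ξ (clamp T t) • a ξ - picardIterForced c T a b 0 t ξ = -forcing c T b t ξ := by
        simp only [picardIterForced_zero]
        exact sub_add_cancel_left _ _
      have hE1 : Real.exp (-lam * t) ≤ 1 := by
        rw [Real.exp_le_one_iff]; nlinarith [ht.1]
      rw [h0, enorm_neg]
      calc ENNReal.ofReal (Real.exp (-lam * t) * (1 + ‖ξ‖) ^ K) * ‖forcing c T b t ξ‖ₑ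
          ≤ ENNReal.ofReal ((1 + ‖ξ‖) ^ K) * ‖forcing c T b t ξ‖ₑ := by
            refine mul_le_mul' (ENNReal.ofReal_le_ofReal ?_) le_rfl
            exact mul_le_of_le_one_left (by positivity) hE1
        _ ≤ RF ξ := hBF t ξ
  | succ n ih =>
    obtain ⟨R, hRm, hRβ, hR⟩ := ih
    obtain ⟨Ψ, hΨm, hΨb, hΨΛ⟩ := hΨ n
    set En : ℝ → EuclideanSpace ℝ (Fin 3) → Fin 3 → ℂ :=
      fun t ξ => heat c ξ (clamp T t) • a ξ - picardIterForced c T a b n t ξ with hEn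
    have hvn : (fun s η => heat c η (clamp T s) • a η - En s η) = picardIterForced c T a b n := by
      funext s η; simp [hEn]
    have hstep : ∀ t ξ, heat c ξ (clamp T t) • a ξ - picardIterForced c T a b (n + 1) t ξ =
        duhamelIntegral c T (fun s η => heat c η (clamp T s) • a η - En s η) t ξ -
          forcing c T b t ξ := by
      intro t ξ
      rw [hvn, picardIterForced_succ, duhamelForced_eq_sub]
      abel
    obtain ⟨-, hEm, -, -⟩ := class_picardIterForced' hc.le hT ha haw hbm hbt hbd n
    set G₀ : EuclideanSpace ℝ (Fin 3) → ℝ≥0∞ := fun η => Amaj η + 3 * Ψ η with hG₀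
    set GK : EuclideanSpace ℝ (Fin 3) → ℝ≥0∞ :=
      fun η => ENNReal.ofReal ((1 + ‖η‖) ^ K) * Amaj η + 3 * R η with hGK
    have hG₀m : AEMeasurable G₀ volume := hAm.add (hΨm.aemeasurable.const_mul _)
    have hGKm : AEMeasurable GK volume :=
      ((measurable_ofReal_weight K).aemeasurable.mul hAm).add (hRm.const_mul _)
    have hGK2 : ∫⁻ η, GK η ^ 2 ≤ 2 * αwK + 18 * (2 * β') := by
      calc ∫⁻ η, GK η ^ 2 ≤ ∫⁻ η, (2 * (ENNReal.ofReal ((1 + ‖η‖) ^ K) * Amaj η) ^ 2 + 2 * (3 * R η) ^ 2) :=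
            lintegral_mono fun η => hsq2 _ _
        _ = 2 * αwK + 18 * ∫⁻ η, R η ^ 2 := by
            rw [lintegral_add_left' (f := fun η => 2 * (ENNReal.ofReal ((1 + ‖η‖) ^ K) * Amaj η) ^ 2)
              ((((measurable_ofReal_weight K).aemeasurable.mul hAm).pow_const 2).const_mul _),
              lintegral_const_mul' _ _ (by norm_num), ← hαwK]
            have h9 : ∀ η, 2 * (3 * R η) ^ 2 = 18 * R η ^ 2 := fun η => by ring
            simp_rw [h9]
            rw [lintegral_const_mul' _ _ (by norm_num)]
        _ ≤ 2 * αwK + 18 * (2 * β') := add_le_add le_rfl (mul_le_mul' le_rfl hRβ)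
    set Rduh : EuclideanSpace ℝ (Fin 3) → ℝ≥0∞ := fun ξ => μ * ((G₀ ⋆ₗ GK) ξ + (GK ⋆ₗ G₀) ξ) with hRduh
    have hRduhm : AEMeasurable Rduh volume :=
      ((aemeasurable_lconvolution hG₀m hGKm).add (aemeasurable_lconvolution hGKm hG₀m)).const_mul μ
    refine ⟨fun ξ => Rduh ξ + RF ξ, hRduhm.add hRFm, ?_, fun t ht ξ => ?_⟩
    · have hRduh2 : ∫⁻ ξ, Rduh ξ ^ 2 ≤ μ ^ 2 * (4 * (γ ^ 2 * (2 * αwK + 18 * (2 * β')))) := by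
        calc ∫⁻ ξ, Rduh ξ ^ 2 ≤ μ ^ 2 * (4 * ((∫⁻ η, G₀ η) ^ 2 * ∫⁻ η, GK η ^ 2)) :=
              lintegral_symm_lconv_sq_le hGKm hG₀m μ
          _ ≤ μ ^ 2 * (4 * (γ ^ 2 * (2 * αwK + 18 * (2 * β')))) := by
              gcongr
              · exact hG₀L1 hΨm hΨΛ
      calc ∫⁻ ξ, (Rduh ξ + RF ξ) ^ 2 ≤ ∫⁻ ξ, (2 * Rduh ξ ^ 2 + 2 * RF ξ ^ 2) :=
            lintegral_mono fun ξ => hsq2 _ _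
        _ = 2 * (∫⁻ ξ, Rduh ξ ^ 2) + 2 * ρF := by
            rw [lintegral_add_left' ((hRduhm.pow_const 2).const_mul _), lintegral_const_mul' _ _ (by norm_num),
              lintegral_const_mul' _ _ (by norm_num)]
        _ ≤ 2 * (μ ^ 2 * (4 * (γ ^ 2 * (2 * αwK + 18 * (2 * β'))))) + 2 * ρF :=
            add_le_add (mul_le_mul' le_rfl hRduh2) le_rfl
        _ = 16 * (μ ^ 2 * γ ^ 2) * αwK + 288 * (μ ^ 2 * γ ^ 2) * β' + 2 * ρF := by ring
        _ ≤ 288 * (μ ^ 2 * γ ^ 2) * αwK + 288 * (μ ^ 2 * γ ^ 2) * β' + 2 * ρF :=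
            add_le_add (add_le_add (mul_le_mul' (mul_le_mul' (by norm_num) le_rfl) le_rfl) le_rfl) le_rfl
        _ ≤ 1 * αwK + 1 * β' + 2 * ρF :=
            add_le_add (add_le_add (mul_le_mul' hkey le_rfl) (mul_le_mul' hkey le_rfl)) le_rfl
        _ = 2 * β' := by rw [hβ', one_mul, one_mul]; ring
    · rw [hstep]
      have hΨ' : ∀ s ∈ Icc 0 T, ∀ η, ‖En s η‖ₑ ≤ Ψ η := fun s _ η => hΨb s η
      have hmain := exp_weight_enorm_duhamelIntegral_hsub_le' (T := T) hc ha hEm K hlam0 hΨ' hR ht ξ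
      have hE1 : Real.exp (-lam * t) ≤ 1 := by
        rw [Real.exp_le_one_iff]; nlinarith [ht.1]
      have hF' : ENNReal.ofReal (Real.exp (-lam * t) * (1 + ‖ξ‖) ^ K) * ‖forcing c T b t ξ‖ₑ ≤ RF ξ :=
        calc ENNReal.ofReal (Real.exp (-lam * t) * (1 + ‖ξ‖) ^ K) * ‖forcing c T b t ξ‖ₑ
            ≤ ENNReal.ofReal ((1 + ‖ξ‖) ^ K) * ‖forcing c T b t ξ‖ₑ := by
              refine mul_le_mul' (ENNReal.ofReal_le_ofReal ?_) le_rfl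
              exact mul_le_of_le_one_left (by positivity) hE1
          _ ≤ RF ξ := hBF t ξ
      calc ENNReal.ofReal (Real.exp (-lam * t) * (1 + ‖ξ‖) ^ K) *
            ‖duhamelIntegral c T (fun s η => heat c η (clamp T s) • a η - En s η) t ξ - forcing c T b t ξ‖ₑ
          ≤ ENNReal.ofReal (Real.exp (-lam * t) * (1 + ‖ξ‖) ^ K) *
              (‖duhamelIntegral c T (fun s η => heat c η (clamp T s) • a η - En s η) t ξ‖ₑ +
                ‖forcing c T b t ξ‖ₑ) := mul_le_mul' le_rfl (enorm_sub_le)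
        _ = ENNReal.ofReal (Real.exp (-lam * t) * (1 + ‖ξ‖) ^ K) *
              ‖duhamelIntegral c T (fun s η => heat c η (clamp T s) • a η - En s η) t ξ‖ₑ +
            ENNReal.ofReal (Real.exp (-lam * t) * (1 + ‖ξ‖) ^ K) * ‖forcing c T b t ξ‖ₑ := mul_add _ _ _
        _ ≤ Rduh ξ + RF ξ := by
            refine add_le_add (hmain.trans (le_of_eq ?_)) hF'
            simp only [hRduh, hμ, hG₀, hGK, hAmaj, hC]
            ring

/-- **Uniform weighted majorants of the Duhamel parts of the forced Picard iterates, every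
order.** Under the hypotheses of `picard_uniform_bounds_forced` (finite `δ₁, δ₂`) and for every `K`,
there are `λ > 0` and a finite `β` such that every `E_n = h − picardIterForced c T a b n` admits a
measurable `R_n` with `∫⁻ R_n² ≤ β` and `e^{-λt}(1+‖ξ‖)^K ‖E_n(t, ξ)‖ₑ ≤ R_n(ξ)` for
`t ∈ [0, T]` (`R_0 = R_F = T·B_{K+2}(1+‖ξ‖)^{-2}` the weighted envelope of the forcing term,
`R_{n+1} = μ((G₀ ⋆ₗ G_K) + (G_K ⋆ₗ G₀)) + R_F`, Young, and the choice `λ = 72 (C_N 2^K γ)²/c + 1`,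
`γ ≥ ‖G₀‖_{L¹}` uniformly, `β = 2∫⁻((1+‖η‖)^K∑ⱼ‖aⱼ‖ₑ)² + 4∫⁻R_F²`). This is the
`L^∞_t H^K_x`-type bound "`‖u‖_{X^k} ≲_{k, ‖u₀‖_{H^k}, ‖f‖_{L¹_tH^k_x}, 1}`" of Thm. 5.4 (ii) for the
approximating sequence of the forced Duhamel map, in exponentially time-weighted form.
[cite: Tao2011, Thm. 5.4 (ii) (arXiv Thm. 31), proof of Thm. 5.1 (arXiv Thm. 28, p. 16)] -/
theorem exists_uniform_weighted_majorant_picardIterForced (hc : 0 < c) (hT : 0 ≤ T)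
    (ha : AEStronglyMeasurable a volume)
    (haw : ∀ (k : ℕ) j, ∫⁻ η, (ENNReal.ofReal ((1 + ‖η‖) ^ k) * ‖a η j‖ₑ) ^ 2 < ⊤)
    (hbc : Continuous (uncurry b)) (hbd : ∀ K : ℕ, ∃ B : ℝ, ∀ s, HasDecay K B (b s))
    {δ₁ δ₂ : ℝ≥0∞} (hδ₁ : δ₁ < ⊤) (hδ₂ : δ₂ < ⊤)
    (hα₁ : ∫⁻ η, (ENNReal.ofReal ‖η‖ * ∑ j, ‖a η j‖ₑ) ^ 2 ≤ δ₁)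
    (hα₂ : ∫⁻ η, (ENNReal.ofReal (‖η‖ ^ 2) * ∑ j, ‖a η j‖ₑ) ^ 2 ≤ δ₂)
    (hF₁ : ∀ t ∈ Icc 0 T, ∫⁻ η, (ENNReal.ofReal ‖η‖ * ∑ j, ‖forcing c T b t η j‖ₑ) ^ 2 ≤ δ₁)
    (hG₁ : ∫⁻ t in Ioc 0 T, ∫⁻ η, (ENNReal.ofReal (‖η‖ ^ 2) *
      ∑ j, ‖forcing c T b t η j‖ₑ) ^ 2 ≤ ENNReal.ofReal c⁻¹ * δ₁)
    (hF₂ : ∀ t ∈ Icc 0 T, ∫⁻ η, (ENNReal.ofReal (‖η‖ ^ 2) * ∑ j, ‖forcing c T b t η j‖ₑ) ^ 2 ≤ δ₂)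
    (hG₂ : ∫⁻ t in Ioc 0 T, ∫⁻ η, (ENNReal.ofReal (‖η‖ ^ 3) *
      ∑ j, ‖forcing c T b t η j‖ₑ) ^ 2 ≤ ENNReal.ofReal c⁻¹ * δ₂)
    (hs : 36864 * (ENNReal.ofReal (4 * π) * (Fintype.card (Fin 3) : ℝ≥0∞) ^ 2) ^ 2 *
        ((SNormLESNormFDerivOfEqConst ℂ (volume : Measure (EuclideanSpace ℝ (Fin 3))) 2 *
          ENNReal.ofReal (2 * π)) ^ (3 / 2 : ℝ)) ^ 2 * ENNReal.ofReal c⁻¹ *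
        (ENNReal.ofReal T * ENNReal.ofReal c⁻¹) ^ (1 / 2 : ℝ) * δ₁ ≤ 1) (K : ℕ) :
    ∃ lam : ℝ, 0 < lam ∧ ∃ β : ℝ≥0∞, β < ⊤ ∧ ∀ n : ℕ,
      ∃ R : EuclideanSpace ℝ (Fin 3) → ℝ≥0∞, AEMeasurable R volume ∧ ∫⁻ ξ, R ξ ^ 2 ≤ β ∧
        ∀ t ∈ Icc 0 T, ∀ ξ, ENNReal.ofReal (Real.exp (-lam * t) * (1 + ‖ξ‖) ^ K) *
          ‖heat c ξ (clamp T t) • a ξ - picardIterForced c T a b n t ξ‖ₑ ≤ R ξ :=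
  exists_uniform_weighted_majorant_picardIterForced' hc hT ha haw
    hbc.measurable (fun ξ => hbc.uncurry_right ξ) hbd hδ₁ hδ₂ hα₁ hα₂ hF₁ hG₁ hF₂ hG₂ hs K

/-- **Pointwise polynomial decay of every order, uniformly along the forced Picard iteration.**
Under the hypotheses of `picard_uniform_bounds_forced` (finite `δ₁, δ₂`), for every `K` there is
`B` with `HasDecay K B (E_n t)` for ALL `n` and all `t ∈ ℝ` (`E_n = h − picardIterForced c T a b n`;
Cauchy–Schwarz on `R_{n+1}`'s convolution part with the uniform `L²` bounds of `G₀`, `G_K`,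
`e^{λt} ≤ e^{λT}`, times outside `[0, T]` through the clamped time, plus the order-`K` decay of the
forcing term). [cite: Tao2011, Thm. 5.4 (ii)+(iv) (arXiv Thm. 31)]
Twin for the wide (jointly measurable, time-continuous at each frequency) class of `E`. -/
theorem exists_uniform_hasDecay_picardIterForced' (hc : 0 < c) (hT : 0 ≤ T)
    (ha : AEStronglyMeasurable a volume)
    (haw : ∀ (k : ℕ) j, ∫⁻ η, (ENNReal.ofReal ((1 + ‖η‖) ^ k) * ‖a η j‖ₑ) ^ 2 < ⊤)
    (hbm : Measurable (uncurry b)) (hbt : ∀ ξ, Continuous fun s => b s ξ) (hbd : ∀ K : ℕ, ∃ B : ℝ, ∀ s, HasDecay K B (b s))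
    {δ₁ δ₂ : ℝ≥0∞} (hδ₁ : δ₁ < ⊤) (hδ₂ : δ₂ < ⊤)
    (hα₁ : ∫⁻ η, (ENNReal.ofReal ‖η‖ * ∑ j, ‖a η j‖ₑ) ^ 2 ≤ δ₁)
    (hα₂ : ∫⁻ η, (ENNReal.ofReal (‖η‖ ^ 2) * ∑ j, ‖a η j‖ₑ) ^ 2 ≤ δ₂)
    (hF₁ : ∀ t ∈ Icc 0 T, ∫⁻ η, (ENNReal.ofReal ‖η‖ * ∑ j, ‖forcing c T b t η j‖ₑ) ^ 2 ≤ δ₁)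
    (hG₁ : ∫⁻ t in Ioc 0 T, ∫⁻ η, (ENNReal.ofReal (‖η‖ ^ 2) *
      ∑ j, ‖forcing c T b t η j‖ₑ) ^ 2 ≤ ENNReal.ofReal c⁻¹ * δ₁)
    (hF₂ : ∀ t ∈ Icc 0 T, ∫⁻ η, (ENNReal.ofReal (‖η‖ ^ 2) * ∑ j, ‖forcing c T b t η j‖ₑ) ^ 2 ≤ δ₂)
    (hG₂ : ∫⁻ t in Ioc 0 T, ∫⁻ η, (ENNReal.ofReal (‖η‖ ^ 3) *
      ∑ j, ‖forcing c T b t η j‖ₑ) ^ 2 ≤ ENNReal.ofReal c⁻¹ * δ₂)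
    (hs : 36864 * (ENNReal.ofReal (4 * π) * (Fintype.card (Fin 3) : ℝ≥0∞) ^ 2) ^ 2 *
        ((SNormLESNormFDerivOfEqConst ℂ (volume : Measure (EuclideanSpace ℝ (Fin 3))) 2 *
          ENNReal.ofReal (2 * π)) ^ (3 / 2 : ℝ)) ^ 2 * ENNReal.ofReal c⁻¹ *
        (ENNReal.ofReal T * ENNReal.ofReal c⁻¹) ^ (1 / 2 : ℝ) * δ₁ ≤ 1) (K : ℕ) :
    ∃ B : ℝ, ∀ n t, HasDecay K B (fun ξ => heat c ξ (clamp T t) • a ξ - picardIterForced c T a b n t ξ) := by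
  obtain ⟨Λ, hΛ, hΨ⟩ := exists_uniform_envelope_picardIterForced' hc hT ha haw hbm hbt hbd hδ₁ hδ₂ hα₁ hα₂
    hF₁ hG₁ hF₂ hG₂ hs
  obtain ⟨lam, hlam, β, hβ, hR⟩ := exists_uniform_weighted_majorant_picardIterForced' hc hT ha haw hbm hbt hbd
    hδ₁ hδ₂ hα₁ hα₂ hF₁ hG₁ hF₂ hG₂ hs K
  -- the order-`K` decay of the forcing term
  obtain ⟨BK, hBK⟩ := exists_hasDecay_forcing (c := c) hc.le hT hbd K
  have hBK0 : 0 ≤ BK := (hBK 0).nonneg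
  set C : ℝ≥0∞ := ENNReal.ofReal (4 * π) * (Fintype.card (Fin 3) : ℝ≥0∞) ^ 2 with hC
  have hCtop : C < ⊤ := ENNReal.mul_lt_top ENNReal.ofReal_lt_top (by simp)
  set Amaj : EuclideanSpace ℝ (Fin 3) → ℝ≥0∞ := fun η => ∑ j, ‖a η j‖ₑ with hAmaj
  have hAm : AEMeasurable Amaj volume := aemeasurable_majorant ha
  set αw0 : ℝ≥0∞ := ∫⁻ η, Amaj η ^ 2 with hαw0
  have hαw0top : αw0 < ⊤ := by
    have h := lintegral_weight_majorant_sq_lt_top ha 0 (haw 0)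
    simpa using h
  set αwK : ℝ≥0∞ := ∫⁻ η, (ENNReal.ofReal ((1 + ‖η‖) ^ K) * Amaj η) ^ 2 with hαwK
  have hαwKtop : αwK < ⊤ := lintegral_weight_majorant_sq_lt_top ha K (haw K)
  have hrt : ∀ {x : ℝ≥0∞}, x < ⊤ → x ^ (1 / 2 : ℝ) < ⊤ := fun h =>
    ENNReal.rpow_lt_top_of_nonneg (by norm_num) h.ne
  set μ : ℝ≥0∞ := ENNReal.ofReal (1 / (2 * Real.sqrt (c * lam))) * (C * 2 ^ K) with hμ
  have hμtop : μ < ⊤ := ENNReal.mul_lt_top ENNReal.ofReal_lt_top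
    (ENNReal.mul_lt_top hCtop (ENNReal.pow_lt_top (by simp)))
  set bb : ℝ≥0∞ := μ * (2 * ((2 * αw0 + 18 * Λ) ^ (1 / 2 : ℝ) * (2 * αwK + 18 * β) ^ (1 / 2 : ℝ))) with hbb
  have hbbtop : bb < ⊤ := by
    refine ENNReal.mul_lt_top hμtop (ENNReal.mul_lt_top (by norm_num) (ENNReal.mul_lt_top ?_ ?_))
    · exact hrt (ENNReal.add_lt_top.2 ⟨ENNReal.mul_lt_top (by norm_num) hαw0top,
        ENNReal.mul_lt_top (by norm_num) hΛ⟩)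
    · exact hrt (ENNReal.add_lt_top.2 ⟨ENNReal.mul_lt_top (by norm_num) hαwKtop,
        ENNReal.mul_lt_top (by norm_num) hβ⟩)
  set b' : ℝ≥0∞ := ENNReal.ofReal (Real.exp (lam * T)) * bb with hb'
  have hb'top : b' ≠ ⊤ := ENNReal.mul_ne_top ENNReal.ofReal_ne_top hbbtop.ne
  refine ⟨b'.toReal + BK, fun n t => ?_⟩
  cases n with
  | zero =>
    intro ξ
    have h0 : heat c ξ (clamp T t) • a ξ - picardIterForced c T a b 0 t ξ = -forcing c T b t ξ := by
      simp only [picardIterForced_zero]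
      exact sub_add_cancel_left _ _
    dsimp only
    rw [h0, norm_neg]
    exact ((hBK t).mono (le_add_of_nonneg_left ENNReal.toReal_nonneg)).le ξ
  | succ n =>
    obtain ⟨R, hRm, hRβ, hRb⟩ := hR n
    obtain ⟨Ψ, hΨm, hΨb, hΨΛ⟩ := hΨ n
    set En : ℝ → EuclideanSpace ℝ (Fin 3) → Fin 3 → ℂ :=
      fun t ξ => heat c ξ (clamp T t) • a ξ - picardIterForced c T a b n t ξ with hEn
    have hvn : (fun s η => heat c η (clamp T s) • a η - En s η) = picardIterForced c T a b n := by
      funext s η; simp [hEn]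
    have hstep : ∀ t ξ, heat c ξ (clamp T t) • a ξ - picardIterForced c T a b (n + 1) t ξ =
        duhamelIntegral c T (fun s η => heat c η (clamp T s) • a η - En s η) (clamp T t) ξ -
          forcing c T b t ξ := by
      intro t ξ
      rw [hvn, picardIterForced_succ, duhamelForced_eq_sub]
      simp only [duhamelIntegral, clamp_clamp hT]
      abel
    obtain ⟨-, hEm, -, -⟩ := class_picardIterForced' hc.le hT ha haw hbm hbt hbd n
    set G₀ : EuclideanSpace ℝ (Fin 3) → ℝ≥0∞ := fun η => Amaj η + 3 * Ψ η with hG₀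
    set GK : EuclideanSpace ℝ (Fin 3) → ℝ≥0∞ :=
      fun η => ENNReal.ofReal ((1 + ‖η‖) ^ K) * Amaj η + 3 * R η with hGK
    have hG₀m : AEMeasurable G₀ volume := hAm.add (hΨm.aemeasurable.const_mul _)
    have hGKm : AEMeasurable GK volume :=
      ((measurable_ofReal_weight K).aemeasurable.mul hAm).add (hRm.const_mul _)
    have hsq : ∀ x y : ℝ≥0∞, (x + y) ^ 2 ≤ 2 * x ^ 2 + 2 * y ^ 2 := fun x y => by
      have h := ENNReal.rpow_add_le_mul_rpow_add_rpow x y (p := 2) (by norm_num)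
      norm_num at h
      rw [← mul_add]
      exact_mod_cast h
    have hG₀2 : ∫⁻ η, G₀ η ^ 2 ≤ 2 * αw0 + 18 * Λ := by
      calc ∫⁻ η, G₀ η ^ 2 ≤ ∫⁻ η, (2 * Amaj η ^ 2 + 2 * (3 * Ψ η) ^ 2) := lintegral_mono fun η => hsq _ _
        _ = 2 * αw0 + 18 * ∫⁻ η, Ψ η ^ 2 := by
            rw [lintegral_add_left' (f := fun η => 2 * Amaj η ^ 2) ((hAm.pow_const 2).const_mul _),
              lintegral_const_mul' _ _ (by norm_num), ← hαw0]
            have h9 : ∀ η, 2 * (3 * Ψ η) ^ 2 = 18 * Ψ η ^ 2 := fun η => by ring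
            simp_rw [h9]
            rw [lintegral_const_mul' _ _ (by norm_num)]
        _ ≤ 2 * αw0 + 18 * Λ := by
            refine add_le_add le_rfl (mul_le_mul' le_rfl ((lintegral_mono fun η => ?_).trans hΨΛ))
            rw [mul_pow]
            calc Ψ η ^ 2 = 1 * Ψ η ^ 2 := (one_mul _).symm
              _ ≤ ENNReal.ofReal ((1 + ‖η‖) ^ 2) ^ 2 * Ψ η ^ 2 :=
                  mul_le_mul' (one_le_pow₀ (one_le_ofReal_weight 2 η)) le_rfl
    have hGK2 : ∫⁻ η, GK η ^ 2 ≤ 2 * αwK + 18 * β := by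
      calc ∫⁻ η, GK η ^ 2 ≤ ∫⁻ η, (2 * (ENNReal.ofReal ((1 + ‖η‖) ^ K) * Amaj η) ^ 2 + 2 * (3 * R η) ^ 2) :=
            lintegral_mono fun η => hsq _ _
        _ = 2 * αwK + 18 * ∫⁻ η, R η ^ 2 := by
            rw [lintegral_add_left' (f := fun η => 2 * (ENNReal.ofReal ((1 + ‖η‖) ^ K) * Amaj η) ^ 2)
              ((((measurable_ofReal_weight K).aemeasurable.mul hAm).pow_const 2).const_mul _),
              lintegral_const_mul' _ _ (by norm_num), ← hαwK]
            have h9 : ∀ η, 2 * (3 * R η) ^ 2 = 18 * R η ^ 2 := fun η => by ring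
            simp_rw [h9]
            rw [lintegral_const_mul' _ _ (by norm_num)]
        _ ≤ 2 * αwK + 18 * β := add_le_add le_rfl (mul_le_mul' le_rfl hRβ)
    -- the Duhamel part: `HasDecay K b'.toReal`
    have hduh : ∀ ξ, ENNReal.ofReal ((1 + ‖ξ‖) ^ K) *
        ‖duhamelIntegral c T (fun s η => heat c η (clamp T s) • a η - En s η) (clamp T t) ξ‖ₑ ≤ b' := by
      intro ξ
      have ht' : clamp T t ∈ Icc 0 T := clamp_mem_Icc hT t
      have hΨ' : ∀ s ∈ Icc 0 T, ∀ η, ‖En s η‖ₑ ≤ Ψ η := fun s _ η => hΨb s η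
      have hmain := exp_weight_enorm_duhamelIntegral_hsub_le' (T := T) hc ha hEm K hlam hΨ' hRb ht' ξ
      have h2 : ENNReal.ofReal (1 / (2 * Real.sqrt (c * lam))) * (ENNReal.ofReal (4 * π) *
          (Fintype.card (Fin 3) : ℝ≥0∞) ^ 2 * 2 ^ K * ((G₀ ⋆ₗ GK) ξ + (GK ⋆ₗ G₀) ξ)) ≤ bb := by
        calc _ = μ * ((G₀ ⋆ₗ GK) ξ + (GK ⋆ₗ G₀) ξ) := by simp only [hμ, hC]; ring
          _ ≤ μ * (2 * ((∫⁻ η, G₀ η ^ 2) ^ (1 / 2 : ℝ) * (∫⁻ η, GK η ^ 2) ^ (1 / 2 : ℝ))) :=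
              symm_lconv_le hGKm hG₀m μ ξ
          _ ≤ bb := mul_le_mul' le_rfl (mul_le_mul' le_rfl (mul_le_mul'
              (ENNReal.rpow_le_rpow hG₀2 (by norm_num)) (ENNReal.rpow_le_rpow hGK2 (by norm_num))))
      have hexp : ENNReal.ofReal ((1 + ‖ξ‖) ^ K) = ENNReal.ofReal (Real.exp (lam * clamp T t)) *
          ENNReal.ofReal (Real.exp (-lam * clamp T t) * (1 + ‖ξ‖) ^ K) := by
        rw [← ENNReal.ofReal_mul (Real.exp_pos _).le, ← mul_assoc, ← Real.exp_add]
        congr 1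
        rw [show lam * clamp T t + -lam * clamp T t = 0 by ring, Real.exp_zero, one_mul]
      calc ENNReal.ofReal ((1 + ‖ξ‖) ^ K) *
            ‖duhamelIntegral c T (fun s η => heat c η (clamp T s) • a η - En s η) (clamp T t) ξ‖ₑ
          = ENNReal.ofReal (Real.exp (lam * clamp T t)) *
              (ENNReal.ofReal (Real.exp (-lam * clamp T t) * (1 + ‖ξ‖) ^ K) *
                ‖duhamelIntegral c T (fun s η => heat c η (clamp T s) • a η - En s η) (clamp T t) ξ‖ₑ) := by
            rw [hexp, mul_assoc]
        _ ≤ ENNReal.ofReal (Real.exp (lam * clamp T t)) * bb := mul_le_mul' le_rfl (hmain.trans h2)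
        _ ≤ ENNReal.ofReal (Real.exp (lam * T)) * bb := by
            refine mul_le_mul' (ENNReal.ofReal_le_ofReal (Real.exp_le_exp.2 ?_)) le_rfl
            exact mul_le_mul_of_nonneg_left ht'.2 hlam.le
    have hduh' : HasDecay K b'.toReal
        (duhamelIntegral c T (fun s η => heat c η (clamp T s) • a η - En s η) (clamp T t)) :=
      hasDecay_of_weight_mul_enorm_le hb'top hduh
    intro ξ
    dsimp only
    rw [hstep]
    exact (hduh'.sub (hBK t)) ξ

/-- **Pointwise polynomial decay of every order, uniformly along the forced Picard iteration.**
Under the hypotheses of `picard_uniform_bounds_forced` (finite `δ₁, δ₂`), for every `K` there is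
`B` with `HasDecay K B (E_n t)` for ALL `n` and all `t ∈ ℝ` (`E_n = h − picardIterForced c T a b n`;
Cauchy–Schwarz on `R_{n+1}`'s convolution part with the uniform `L²` bounds of `G₀`, `G_K`,
`e^{λt} ≤ e^{λT}`, times outside `[0, T]` through the clamped time, plus the order-`K` decay of the
forcing term). [cite: Tao2011, Thm. 5.4 (ii)+(iv) (arXiv Thm. 31)] -/
theorem exists_uniform_hasDecay_picardIterForced (hc : 0 < c) (hT : 0 ≤ T)
    (ha : AEStronglyMeasurable a volume)
    (haw : ∀ (k : ℕ) j, ∫⁻ η, (ENNReal.ofReal ((1 + ‖η‖) ^ k) * ‖a η j‖ₑ) ^ 2 < ⊤)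
    (hbc : Continuous (uncurry b)) (hbd : ∀ K : ℕ, ∃ B : ℝ, ∀ s, HasDecay K B (b s))
    {δ₁ δ₂ : ℝ≥0∞} (hδ₁ : δ₁ < ⊤) (hδ₂ : δ₂ < ⊤)
    (hα₁ : ∫⁻ η, (ENNReal.ofReal ‖η‖ * ∑ j, ‖a η j‖ₑ) ^ 2 ≤ δ₁)
    (hα₂ : ∫⁻ η, (ENNReal.ofReal (‖η‖ ^ 2) * ∑ j, ‖a η j‖ₑ) ^ 2 ≤ δ₂)
    (hF₁ : ∀ t ∈ Icc 0 T, ∫⁻ η, (ENNReal.ofReal ‖η‖ * ∑ j, ‖forcing c T b t η j‖ₑ) ^ 2 ≤ δ₁)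
    (hG₁ : ∫⁻ t in Ioc 0 T, ∫⁻ η, (ENNReal.ofReal (‖η‖ ^ 2) *
      ∑ j, ‖forcing c T b t η j‖ₑ) ^ 2 ≤ ENNReal.ofReal c⁻¹ * δ₁)
    (hF₂ : ∀ t ∈ Icc 0 T, ∫⁻ η, (ENNReal.ofReal (‖η‖ ^ 2) * ∑ j, ‖forcing c T b t η j‖ₑ) ^ 2 ≤ δ₂)
    (hG₂ : ∫⁻ t in Ioc 0 T, ∫⁻ η, (ENNReal.ofReal (‖η‖ ^ 3) *
      ∑ j, ‖forcing c T b t η j‖ₑ) ^ 2 ≤ ENNReal.ofReal c⁻¹ * δ₂)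
    (hs : 36864 * (ENNReal.ofReal (4 * π) * (Fintype.card (Fin 3) : ℝ≥0∞) ^ 2) ^ 2 *
        ((SNormLESNormFDerivOfEqConst ℂ (volume : Measure (EuclideanSpace ℝ (Fin 3))) 2 *
          ENNReal.ofReal (2 * π)) ^ (3 / 2 : ℝ)) ^ 2 * ENNReal.ofReal c⁻¹ *
        (ENNReal.ofReal T * ENNReal.ofReal c⁻¹) ^ (1 / 2 : ℝ) * δ₁ ≤ 1) (K : ℕ) :
    ∃ B : ℝ, ∀ n t, HasDecay K B (fun ξ => heat c ξ (clamp T t) • a ξ - picardIterForced c T a b n t ξ) :=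
  exists_uniform_hasDecay_picardIterForced' hc hT ha haw
    hbc.measurable (fun ξ => hbc.uncurry_right ξ) hbd hδ₁ hδ₂ hα₁ hα₂ hF₁ hG₁ hF₂ hG₂ hs K

end Literature.Analysis.FluidPDE.FourierNS

end
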